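import Summits.AtomisticToContinuum.FouriersLaw.Theses.HoelderEscapeProfile
import Summits.AtomisticToContinuum.FouriersLaw.Theorems.HoelderEscapeProfileFibreCalculus
import Summits.AtomisticToContinuum.FouriersLaw.Theorems.HoelderEscapeProfileAbelSpreadCeilingCanonicalTwin
import Summits.AtomisticToContinuum.FouriersLaw.Theorems.EmbeddedDrudeMourreAbelThermodynamicLimitFixedFrequencyMatching
import Summits.AtomisticToContinuum.FouriersLaw.Theorems.EmbeddedDrudeMourreAbelThermodynamicLimitRegularDLRUnique
import Summits.AtomisticToContinuum.FouriersLaw.Theorems.EmbeddedDrudeMourreAbelThermodynamicLimitOfLowerBound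
import Summits.AtomisticToContinuum.FouriersLaw.Theorems.OddSectorIrreversibilityCorrectorTheoryExistence
import Literature.MathematicalPhysics.KineticTheory.InfiniteChainShiftInvariantUniqueness
import HarnessLib

/-!
# `AbelSpreadCeiling` from the route's own (R) — the certificate of line `regularity_collapse`
(crux `HoelderEscapeProfile.AbelSpreadCeiling`, item stmt-AtomisticToContinuum-16010; `--supports` file: it closes nothing,
it REDUCES the crux to the existing item stmt-AtomisticToContinuum-13416; line lead, 2026-08-17, cycle 1)

WHAT. `abelSpreadCeiling_of_uniformAbelianRegularity : UniformAbelianRegularity → AbelSpreadCeiling` (hypothesis = the route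
decl `HoelderEscapeProfile.UniformAbelianRegularity`, item stmt-13416, shared verbatim with CoercivePulse / EmbeddedDrudeMourre /
StaticAbelianSqueeze / CageBudgetFekete; conclusion = the crux decl). With this theorem the crux `AbelSpreadCeiling` carries no
mathematical content beyond (R): it closes the moment stmt-13416 closes (tenure planner: `route edit --split AbelSpreadCeiling
--into UniformAbelianRegularity --glue-by` this theorem, or close-on-close).

HOW (every ingredient is a landed theorem). For a guarded pair `(μ, D)` of `pinnedChain ω₂ lam β γ` at `T`:
(1) Helfand–Abel `∫₀^∞e^{−νt}C_T = (ν/2)(Σ_x x²S̄_ν − Σ_x x²S(·,0))` = clause (12) of the PROVED route item `FibreCalculus`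
(`Theorems.FibreCalculusSketch.fibreCalculus_proof`, stmt-16011); (2) the canonical Buttà–Marchioro twin `D'` of `D`
(`Theorems.AbelSpreadCeiling.RegularityCollapse.stub_canonicalTwin`: carrier `bmGood`, preserves `μ`, absolutely convergent
correlations, same `C_T`), transported to bath constant `1` (the infinite-volume objects do not see `γ`); (3) DLR uniqueness +
superstability + the fixed-frequency matching `F_N(ν)/N → Â(ν)` (`LoomisCompactHorizonWitness.stub_regularDLRUnique`,
`stub_fixedFrequencyMatching`); (4) the open chain at bath constant `1`: `nessUnique_proof`, `exists_steadyFamily_response`,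
integrability of `c_N` from `Corrector.openChainGreenKubo_holds` + `integral_totalBondCurrent_gibbsMeasure`; (5) (R) at `ε = 1`
and the pure real-analysis `abel_bound_of_regularity` at `ν₁ = ν₀/2`: `Â(ν) ≤ |Â(ν₁)| + 3` for `ν < ν₀`; (6) Helfand–Abel
turns it into `Σ_x x²S̄_ν ≤ (2(|Â(ν₁)|+3) + |M₀|)/ν` for `0 < ν ≤ min(ν₀/2, 1)`. Composition text = the registered skeleton
`Cruxes/AbelSpreadCeiling/Lines/regularity_collapse.lean` (strategist planner-cstrat-…-16010-b1-0, reshaped by the lead).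
-/

noncomputable section

open MeasureTheory Filter Set
open scoped Topology BigOperators NNReal

namespace Summit.AtomisticToContinuum.FouriersLaw.Theorems.AbelSpreadCeiling.RegularityCollapse

open Literature.MathematicalPhysics.KineticTheory.HeatConduction

/-- **Abel splitting identity.** For `c` integrable on `(0,∞)` and `ν > 0`, `e^{−νt}c` is integrable there and
`∫₀^∞ (1 − e^{−νt}) c = ∫₀^∞ c − ∫₀^∞ e^{−νt} c`. [folklore] -/
theorem integral_one_sub_exp_mul (c : ℝ → ℝ) {ν : ℝ} (hν : 0 < ν) (hc : IntegrableOn c (Ioi 0)) :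
    ∫ t in Ioi (0:ℝ), (1 - Real.exp (-(ν * t))) * c t =
      (∫ t in Ioi (0:ℝ), c t) - ∫ t in Ioi (0:ℝ), Real.exp (-(ν * t)) * c t := by
  have hmeas : AEStronglyMeasurable (fun t : ℝ => Real.exp (-(ν * t))) (volume.restrict (Ioi 0)) :=
    (Real.continuous_exp.comp (continuous_const.mul continuous_id).neg).aestronglyMeasurable
  have hbound : ∀ᵐ t ∂(volume.restrict (Ioi (0:ℝ))), ‖Real.exp (-(ν * t))‖ ≤ 1 := by
    rw [ae_restrict_iff' measurableSet_Ioi]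
    refine Eventually.of_forall fun t ht => ?_
    rw [Real.norm_eq_abs, abs_of_pos (Real.exp_pos _), Real.exp_le_one_iff]
    have : 0 ≤ ν * t := mul_nonneg hν.le (le_of_lt ht)
    linarith
  have h1 : IntegrableOn (fun t => Real.exp (-(ν * t)) * c t) (Ioi 0) := hc.bdd_mul hmeas hbound
  have h2 : (fun t => (1 - Real.exp (-(ν * t))) * c t) = fun t => c t - Real.exp (-(ν * t)) * c t := by
    funext t; ring
  rw [h2, integral_sub hc h1]

/-- **Abel bound from regularity (pure real analysis; the heart of the collapse).** Let `c_N` be eventually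
integrable on `(0,∞)`, `|∫₀^∞(1−e^{−νt})c_N| ≤ N` eventually in `N` for every `ν ∈ (0, ν₀)` ((R) with `ε = 1`), and
let the normalised Abel mean at ONE frequency `ν₁ ∈ (0, ν₀)` converge, `(∫₀^∞e^{−ν₁t}c_N)/N → a₁`. Then for every
`ν ∈ (0, ν₀)`, eventually in `N`, `(∫₀^∞e^{−νt}c_N)/N ≤ |a₁| + 3` (`|∫c_N| ≤ (|a₁|+2)N` by the triangle inequality at
`ν₁`, then `∫e^{−νt}c_N ≤ |∫c_N| + N`). [folklore] -/
theorem abel_bound_of_regularity (c : ℕ → ℝ → ℝ) {ν₀ ν₁ a₁ : ℝ}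
    (hint : ∀ᶠ N : ℕ in atTop, IntegrableOn (c N) (Ioi 0))
    (hR : ∀ ν : ℝ, 0 < ν → ν < ν₀ → ∀ᶠ N : ℕ in atTop,
      |∫ t in Ioi (0:ℝ), (1 - Real.exp (-(ν * t))) * c N t| ≤ 1 * N)
    (hν₁ : 0 < ν₁) (hν₁' : ν₁ < ν₀)
    (hlim : Tendsto (fun N : ℕ => (∫ t in Ioi (0:ℝ), Real.exp (-(ν₁ * t)) * c N t) / (N : ℝ))
      atTop (𝓝 a₁)) :
    ∀ ν : ℝ, 0 < ν → ν < ν₀ → ∀ᶠ N : ℕ in atTop,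
      (∫ t in Ioi (0:ℝ), Real.exp (-(ν * t)) * c N t) / (N : ℝ) ≤ |a₁| + 3 := by
  intro ν hν hν'
  have hball : ∀ᶠ N : ℕ in atTop,
      dist ((∫ t in Ioi (0:ℝ), Real.exp (-(ν₁ * t)) * c N t) / (N : ℝ)) a₁ < 1 :=
    hlim (Metric.ball_mem_nhds a₁ one_pos)
  filter_upwards [hint, hR ν₁ hν₁ hν₁', hR ν hν hν', hball, eventually_ge_atTop 1] with N hcN hR₁ hRν hb h1N
  have hNpos : (0:ℝ) < N := by exact_mod_cast h1N
  rw [integral_one_sub_exp_mul (c N) hν₁ hcN] at hR₁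
  rw [integral_one_sub_exp_mul (c N) hν hcN] at hRν
  set F₁ := ∫ t in Ioi (0:ℝ), Real.exp (-(ν₁ * t)) * c N t with hF₁
  set F := ∫ t in Ioi (0:ℝ), Real.exp (-(ν * t)) * c N t with hF
  set I := ∫ t in Ioi (0:ℝ), c N t with hI
  rw [Real.dist_eq] at hb
  have hF₁b : |F₁| ≤ (|a₁| + 1) * N := by
    have e1 : |F₁ / N| < |a₁| + 1 := by
      have := abs_sub_abs_le_abs_sub (F₁ / N) a₁
      linarith
    rw [abs_div, abs_of_pos hNpos, div_lt_iff₀ hNpos] at e1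
    linarith
  have hIb : |I| ≤ (|a₁| + 2) * N := by
    have e := abs_sub_abs_le_abs_sub I F₁
    linarith
  have hFb : F ≤ (|a₁| + 3) * N := by
    have e1 := neg_abs_le (I - F)
    have e2 := le_abs_self I
    linarith
  rw [div_le_iff₀ hNpos]
  exact hFb

/-- **`AbelSpreadCeiling` is a consequence of the route's own (R).** For the pinned anharmonic chain, N-uniform Abelian
regularity of the open chain's equilibrium current autocorrelation (`HoelderEscapeProfile.UniformAbelianRegularity`, item
stmt-AtomisticToContinuum-13416) implies the Abel spread ceiling `Σ_x x²S̄_ν(x) ≤ B/ν` for every guarded pair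
(`HoelderEscapeProfile.AbelSpreadCeiling`, item stmt-AtomisticToContinuum-16010), over landed theorems only (FibreCalculus clause
(12), the canonical twin, fixed-frequency matching, the open-chain Green–Kubo identity). [folklore] -/
theorem abelSpreadCeiling_of_uniformAbelianRegularity
    (hRstub : _root_.Summit.AtomisticToContinuum.FouriersLaw.Theses.HoelderEscapeProfile.UniformAbelianRegularity) :
    _root_.Summit.AtomisticToContinuum.FouriersLaw.Theses.HoelderEscapeProfile.AbelSpreadCeiling := by
  intro ω₂ lam β γ hω hl hβ T hT μ hG hSI hR D hP hSh h hh S hS Sb hSb _hInt _hSum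
  set P₁ := pinnedChain ω₂ lam β 1 with hP₁
  -- Helfand–Abel = clause (12) of the PROVED route item FibreCalculus (stmt-AtomisticToContinuum-16011)
  obtain ⟨-, -, -, -, -, -, -, -, -, -, -, hHelf⟩ :=
    Summit.AtomisticToContinuum.FouriersLaw.Theorems.FibreCalculusSketch.fibreCalculus_proof ω₂ lam β γ hω hl hβ T hT
      μ hG hSI hR D hP hSh h hh S hS Sb hSb _ rfl _ rfl _ rfl _ rfl
  -- the canonical BM twin, transported to bath constant 1 (same carrier, flow and fields), and the landed matching
  obtain ⟨D', hcar, -, -, hP', -, hAC', hCC⟩ := stub_canonicalTwin ω₂ lam β γ hω hl hβ T hT μ hG hSI hR D hP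
  let D₁ : InfiniteChainDynamics (pinnedChain ω₂ lam β 1) :=
    ⟨D'.carrier, D'.flow, D'.mapsTo, D'.flow_zero, D'.isSolution, D'.unique⟩
  have hG₁ : (pinnedChain ω₂ lam β 1).IsChainGibbsMeasure T μ := hG
  have hSS₁ : (pinnedChain ω₂ lam β 1).HasSuperstabilityEstimate μ :=
    OscillatorChain.hasSuperstabilityEstimate_of_isShiftInvariant_pinnedChain 1 hω hl.le hβ.le hT hG₁ hSI
  have hcar₁ : D₁.carrier ⊆ (pinnedChain ω₂ lam β 1).bmGood := subset_of_eq hcar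
  have hPres₁ : D₁.PreservesMeasure μ := hP'
  have hAC₁ : ∀ t : ℝ, D₁.HasAbsConvergentCorrelation μ t := hAC'
  have hUniq := Summit.AtomisticToContinuum.FouriersLaw.Theorems.AbelThermodynamicLimit.LoomisCompactHorizonWitness.stub_regularDLRUnique
    ω₂ lam β 1 hω hl hβ one_pos T hT
  have hMatch := Summit.AtomisticToContinuum.FouriersLaw.Theorems.AbelThermodynamicLimit.LoomisCompactHorizonWitness.stub_fixedFrequencyMatching
    ω₂ lam β 1 hω hl hβ one_pos T hT hUniq μ D₁ hG₁ hSI hSS₁ hcar₁ hPres₁ hAC₁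
  have hcc : ∀ t : ℝ, D₁.currentCorrelation μ t = D.currentCorrelation μ t := fun t => by
    rw [← hCC t]; rfl
  -- the open chain at bath constant 1: uniqueness, a steady family, integrability of c_N (landed KDN identity)
  have hUq := Summit.AtomisticToContinuum.FouriersLaw.Theorems.nessUnique_proof ω₂ lam β 1 hω hl hβ one_pos
  obtain ⟨μc, Dc, hμc, -⟩ :=
    Summit.AtomisticToContinuum.FouriersLaw.Theorems.AbelThermodynamicLimit.LoomisCompactHorizonWitness.exists_steadyFamily_response
      ω₂ lam β 1 hω hl hβ one_pos hUq T hT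
  let c : ℕ → ℝ → ℝ := fun N t => ∫ z, (∑ i : Fin N, P₁.bondCurrent N i z) *
      (∫ y, (∑ i : Fin N, P₁.bondCurrent N i y) ∂(P₁.transitionKernel N T T t.toNNReal z)) ∂(P₁.gibbsMeasure N T)
  have hint : ∀ᶠ N : ℕ in atTop, IntegrableOn (c N) (Ioi 0) := by
    rw [eventually_atTop]
    refine ⟨2, fun N hN2 => ?_⟩
    have hGK := Summit.AtomisticToContinuum.FouriersLaw.Theorems.OddSectorIrreversibility.Corrector.openChainGreenKubo_holds
      ω₂ lam β 1 hω hl hβ one_pos hUq μc hμc T hT N hN2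
    have hm0 := Summit.AtomisticToContinuum.FouriersLaw.Theorems.OddSectorIrreversibility.Corrector.integral_totalBondCurrent_gibbsMeasure
      ω₂ lam β 1 N T
    dsimp only at hGK
    rw [hm0, mul_zero] at hGK
    simp only [sub_zero] at hGK
    exact hGK.1
  -- (R) at bath constant 1 with ε = 1
  obtain ⟨ν₀, hν₀, hRν⟩ := hRstub ω₂ lam β 1 hω hl hβ one_pos T hT 1 one_pos
  have hRev : ∀ ν : ℝ, 0 < ν → ν < ν₀ → ∀ᶠ N : ℕ in atTop,
      |∫ t in Ioi (0:ℝ), (1 - Real.exp (-(ν * t))) * c N t| ≤ 1 * N := by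
    intro ν hν hν'
    obtain ⟨N₀, hN₀⟩ := hRν ν hν hν'
    rw [eventually_atTop]
    exact ⟨N₀, fun N hN => hN₀ N hN⟩
  -- the collapse: Â(ν) ≤ |Â(ν₁)| + 3 for ν < ν₀, ν₁ = ν₀/2
  have hν₁ : 0 < ν₀ / 2 := by positivity
  have hν₁' : ν₀ / 2 < ν₀ := by linarith
  set a₁ : ℝ := MeasureTheory.integral (MeasureTheory.volume.restrict (Set.Ioi (0:ℝ)))
    (fun t : ℝ => Real.exp (-(ν₀ / 2 * t)) * D₁.currentCorrelation μ t) with ha₁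
  have hkey := abel_bound_of_regularity c hint hRev hν₁ hν₁' (hMatch (ν₀ / 2) hν₁)
  set B₁ : ℝ := |a₁| + 3 with hB₁
  have hB₁0 : 0 ≤ B₁ := by positivity
  have hAbel : ∀ ν : ℝ, 0 < ν → ν < ν₀ →
      ∫ t in Set.Ioi (0:ℝ), Real.exp (-(ν * t)) * D.currentCorrelation μ t ≤ B₁ := by
    intro ν hν hνlt
    have hle : MeasureTheory.integral (MeasureTheory.volume.restrict (Set.Ioi (0:ℝ)))
        (fun t : ℝ => Real.exp (-(ν * t)) * D₁.currentCorrelation μ t) ≤ B₁ :=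
      le_of_tendsto (hMatch ν hν) (hkey ν hν hνlt)
    simpa only [hcc] using hle
  -- Helfand–Abel: the second moment of the Abel profile
  set M₀ : ℝ := ∑' x : ℤ, (x : ℝ) ^ 2 * S x 0 with hM₀
  refine ⟨2 * B₁ + |M₀|, min (ν₀ / 2) 1, lt_min hν₁ one_pos, fun ν hν hνle => ?_⟩
  have hν1 : ν ≤ 1 := hνle.trans (min_le_right _ _)
  have hνlt : ν < ν₀ := lt_of_le_of_lt (hνle.trans (min_le_left _ _)) hν₁'
  have hb := hAbel ν hν hνlt
  rw [hHelf ν hν] at hb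
  have hMν : (∑' x : ℤ, (x : ℝ) ^ 2 * Sb ν x) ≤ 2 * B₁ / ν + M₀ := by
    have e2 : (∑' x : ℤ, (x : ℝ) ^ 2 * Sb ν x) - M₀ ≤ 2 * B₁ / ν := by
      rw [le_div_iff₀ hν]; nlinarith
    linarith
  have hM₀ν : M₀ ≤ |M₀| / ν := by
    rw [le_div_iff₀ hν]
    have := le_abs_self M₀
    nlinarith [abs_nonneg M₀]
  calc (∑' x : ℤ, (x : ℝ) ^ 2 * Sb ν x) ≤ 2 * B₁ / ν + M₀ := hMν
    _ ≤ 2 * B₁ / ν + |M₀| / ν := by linarith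
    _ = (2 * B₁ + |M₀|) / ν := by ring


end Summit.AtomisticToContinuum.FouriersLaw.Theorems.AbelSpreadCeiling.RegularityCollapse

end
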